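import Summits.BirchSwinnertonDyer.BirchSwinnertonDyer.Theses.UniversalToricDescent
import Summits.BirchSwinnertonDyer.BirchSwinnertonDyer.Theorems.UniversalToricDescentToricTransportModThreeStubRatSqueeze
import Summits.BirchSwinnertonDyer.BirchSwinnertonDyer.Theorems.UniversalToricDescentAcDualMuZeroCriterion
import Summits.BirchSwinnertonDyer.Rank1Residual.WAll.TargetAdditiveAtThreeWildLocalTypeDecompLineMult
import HarnessLib

/-!
# Crux `AdditiveSplitIMCInclusionAtThree` (stmt-BirchSwinnertonDyer-20395) — node `serre_source_transport`
# (crux-ideate cover g14; UNREGISTERED node, `sorry` only in `stub_*`; concludes the crux BY NAME)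

SERRE-SOURCE TRANSPORT.  The wall = RATWALL ∧ (μ-piece) (g7/g10: `CoherenceGlue.AdditiveSplitIMCInclusionAtThree_of`).
This node STRATIFIES the μ-piece `ResidualSelmerFiniteAtThreeSurj` (= `Sel_{𝔭′}(K_∞, E[3^∞])[3]` finite on the
O6 / onto / `r_an = 1` rows) by the SERRE INVARIANTS of `ρ̄ = E[3]` AT 3 — a function of the `D₃`-module `E[3]`
alone — and names the SOURCE OBJECT on the principal stratum:

* stratum R («flat-ordinary residual type», `k(ρ̄) = 2`, niveau 1; typed below as `HasGoodOrdinaryModThreeType`: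
  the `D₃`-module `W[3]` is the `3`-torsion of SOME curve over `ℚ` with good ORDINARY reduction at `3`):
  by Ribet–Diamond–Edixhoven level/weight optimisation for the MODULAR irreducible `ρ̄` (ℓ = 3 > 2, `det ρ̄ = ω`,
  trivial character) there is a newform `g ∈ S₂(Γ₀(N(ρ̄)))` with `ρ̄_{g,λ} ≅ E[3]`, `N(ρ̄) ∣ N(E)/27`
  (Carayol–Livné), hence `3 ∤ N_g` and EVERY prime of `N_g` divides `N(E)` — so `g` satisfies the Heegner
  hypothesis for the SAME `K` as the crux, for free — and `g` is `λ`-ORDINARY (weight 2, `3 ∤ N_g`, `ρ̄|D₃`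
  reducible; Fontaine/Edixhoven: supersingular ⇒ `ρ̄|D₃` irreducible).  The μ-source is then Howard's GL₂-type
  Heegner-point main-conjecture divisibility for the ordinary abelian variety `A_g` + BDP conversion + Hsieh's
  `μ(L_𝔭^{BDP}(g)) = 0`, transported to `E` through the residual `(∅,0)`-Selmer comparison along `ρ̄_{g,λ} ≅ E[3]`
  — `stub_serreSourceRows`.
* complement strata (`k(ρ̄) = 4` très ramifié; `k(ρ̄) = 6`; niveau 2): NO weight-2 prime-to-3 ordinary source exists;
  `stub_complementRows` (UNDECIDED; leaves BARRIER / RESEARCH, see the .md).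

Composition: `residualFinite_of_rows` (excluded middle on the row predicate, PROVED) and the crux BY NAME through
g10's kernel road (`CoherenceGlue.AdditiveSplitIMCInclusionAtThree_of`, proof copied verbatim: the `Cruxes/…/Lines`
modules are not built on the farm, so `ResidualSelmerFiniteAtThreeSurj` is restated with g8/g10's exact text).
References: Ribet–Stein, *Lectures on Serre's conjectures* §1.3 p. 12, §2.1 p. 20, §3 pp. 33–34 [corpus:
paper:doi-10-1090-pcms-009-04]; Howard 2004 Duke 124 [corpus: paper:arxiv-1202.6342 pp. 2–3]; Burungale–Castella–
Skinner 2025 Thm 4.2.1(b)/Prop 4.2.2 (tree `BurungaleCastellaSkinner2025.thm421b_…`, `prop422_…`, typed for curves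
only); Hsieh 2014 Doc. Math. Thm B; T. Nguyen 2025 [corpus: paper:arxiv-2503.00247 Thm A]; Lei–Müller–Xia 2023
arXiv:2302.06553 Thm 1; tree `WAll/TargetAdditiveAtThreeWildLocalType{Slices,DecompLine,DecompLineMult,TresRamifie}`.
-/

set_option linter.dupNamespace false
set_option autoImplicit false

noncomputable section

open scoped NumberField
open IsDedekindDomain
open Literature.NumberTheory.EllipticCurves
open Literature.NumberTheory.EllipticCurves.Rank1Residual (GoodOrd)
open Summit.BirchSwinnertonDyer.Rank1Residual.O6 (ModPCongruentAt)
open Summit.BirchSwinnertonDyer.BirchSwinnertonDyer.Theses.UniversalToricDescent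
  (RationalSplitIMCInclusionAtThree AdditiveSplitIMCInclusionAtThree)
open Summit.BirchSwinnertonDyer.BirchSwinnertonDyer.Cruxes.ToricTransportModThree.RatwallThinComb
  (dvd_of_dvd_prime_pow_mul prime_C_three not_C_three_dvd_of_norm_coeff_eq_one)
open Summit.BirchSwinnertonDyer.Rank1Residual.X11b

namespace Summit.BirchSwinnertonDyer.BirchSwinnertonDyer.Cruxes.AdditiveSplitIMCInclusionAtThree.SerreSourceTransport

/-! ## §0a The μ-half of the wall (verbatim from g8 `DivisionTowerMuFloor` / g10 `CoherenceGlue`, same normalised signature) -/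

/-- μ-piece (UNDECIDED): residual `(∅,0)`-Selmer finiteness `Sel_{𝔭′}(K_∞, E[3^∞])[3]` finite on the O6 / onto /
`r_an = 1` rows — equivalently `μ(X_(∅,0)) = 0` given torsion. Identical text to g8/g10.
[cite: GreenbergVatsal2000, Thm. (1.4), §2 Prop. (2.8)] -/
def ResidualSelmerFiniteAtThreeSurj : Prop :=
  ∀ (W : WeierstrassCurve ℚ) [W.IsElliptic] [W.IsGloballyMinimal] (N : ℕ) [NeZero N]
    (K : Type) [Field K] [NumberField K],
    Summit.BirchSwinnertonDyer.Rank1Residual.Additive.ClassO6 W 3 → W.HasSurjectiveModNGaloisRep 3 →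
    W.analyticRank = 1 → W.conductorNorm ℤ = N →
    IsImaginaryQuadratic K → SatisfiesHeegnerHypothesis N K →
    ∀ (κ : ZpExtension K 3), κ.IsAnticyclotomic →
    ∀ (𝔭' : HeightOneSpectrum (𝓞 K)), ((3 : ℕ) : 𝓞 K) ∈ 𝔭'.asIdeal →
      Set.Finite {s : AcSelmer.selmerAc (W.baseChange K) 3 κ 𝔭' ∅ | (3 : ℕ) • s = 0}

/-! ## §0b The row predicate: Serre stratum R (`k(ρ̄) = 2`, niveau 1) in tree vocabulary -/

/-- **Stratum R — good-ORDINARY mod-3 type at 3.** At the place above `3`, the `D₃`-module `W[3]` is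
`D₃`-equivariantly isomorphic to `W″[3]` for SOME elliptic curve `W″/ℚ` with good ORDINARY reduction at `3`
(GLOBAL witness, LOCAL equivariance — the ordinary analogue of the tree's `O6.HasSemistableModPTypeAt W 3`).
Equivalently (Serre–Tate / Deligne: `W″[3]|D₃ ≅ (ω·λ⁻¹ ∗; 0 λ)` finite flat, `λ` unramified; conversely every such
`D₃`-module is realised by an ordinary curve over `ℚ₃`, hence over `ℚ` by weak approximation + Krasner):
`ρ̄_{W,3}|D₃` is reducible, peu ramifié, with cyclotomic-by-unramified SUB — Serre weight `k(ρ̄) = 2`, niveau 1.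
Census reading: contains bucket A (745 classes with a good-ordinary twin of record). [folklore]
[cite: SerreInventiones1972, §1.11 Prop. 11] [cite: Serre1987, §2.8 Prop. 3, §2.9 Prop. 5] -/
def HasGoodOrdinaryModThreeType (W : WeierstrassCurve ℚ) : Prop :=
  ∀ (v : HeightOneSpectrum (𝓞 ℚ)), ((3 : ℕ) : 𝓞 ℚ) ∈ v.asIdeal →
    ∃ (W'' : WeierstrassCurve ℚ) (_ : W''.IsElliptic) (_ : W''.IsGloballyMinimal),
      GoodOrd W'' 3 ∧ ModPCongruentAt W'' W 3 v

/-! ## §1 The two row pieces of the μ-half (same binders as `ResidualSelmerFiniteAtThreeSurj`, split by §0) -/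

/-- **Stratum-R μ-piece (UNDECIDED · print-adjacent GL₂-type port; the SERRE SOURCE).** On the O6 / onto /
`r_an = 1` rows whose mod-3 type at 3 is good-ordinary, `Sel_{𝔭′}(K_∞, E[3^∞])[3]` is finite.  Proof route
(card §Lever): Serre-optimal ordinary newform `g` of level `N(ρ̄) ∣ N/27` (Heegner for `K` automatically) ⇒
`X_(∅,0)(A_g/K_∞)_λ` torsion with `μ = 0` (Howard GL₂-type + BDP conversion + Hsieh) ⇒ residual `(∅,0)`-Selmer
comparison along `ρ̄_{g,λ} ≅ E[3]` ⇒ the set below is finite.  Why it might fail: Howard 2004 needs the FULL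
`λ`-adic image and `λ` the unique prime of the Hecke field over `3`; the transport needs `(H0)`-type vanishing
`E(K_{∞,w})[3] = 0` at `w ∣ 3`, delicate on additive Kodaira IV/IV* fibres (`c₃ = 3`).
[cite: GreenbergVatsal2000, Thm. (1.4), §2 Prop. (2.8)] -/
def SerreSourceResidualFiniteAtThree : Prop :=
  ∀ (W : WeierstrassCurve ℚ) [W.IsElliptic] [W.IsGloballyMinimal] (N : ℕ) [NeZero N]
    (K : Type) [Field K] [NumberField K],
    Summit.BirchSwinnertonDyer.Rank1Residual.Additive.ClassO6 W 3 → W.HasSurjectiveModNGaloisRep 3 →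
    W.analyticRank = 1 → W.conductorNorm ℤ = N →
    IsImaginaryQuadratic K → SatisfiesHeegnerHypothesis N K →
    HasGoodOrdinaryModThreeType W →
    ∀ (κ : ZpExtension K 3), κ.IsAnticyclotomic →
    ∀ (𝔭' : HeightOneSpectrum (𝓞 K)), ((3 : ℕ) : 𝓞 K) ∈ 𝔭'.asIdeal →
      Set.Finite {s : AcSelmer.selmerAc (W.baseChange K) 3 κ 𝔭' ∅ | (3 : ℕ) • s = 0}

/-- **Complement-strata μ-piece (UNDECIDED; leaves BARRIER / RESEARCH).** The same finiteness on the rows whose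
mod-3 type at 3 is NOT good-ordinary: très ramifié (`k(ρ̄) = 4`, Serre source of weight `4 = p + 1`, the
Fontaine–Laffaille edge), unramified-SUB (`k(ρ̄) = 6`), niveau 2 (supersingular GL₂-type source, signed theory).
No print engine; recorded so that the composition concludes the crux over ALL rows. [folklore] -/
def ComplementRowsResidualFiniteAtThree : Prop :=
  ∀ (W : WeierstrassCurve ℚ) [W.IsElliptic] [W.IsGloballyMinimal] (N : ℕ) [NeZero N]
    (K : Type) [Field K] [NumberField K],
    Summit.BirchSwinnertonDyer.Rank1Residual.Additive.ClassO6 W 3 → W.HasSurjectiveModNGaloisRep 3 →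
    W.analyticRank = 1 → W.conductorNorm ℤ = N →
    IsImaginaryQuadratic K → SatisfiesHeegnerHypothesis N K →
    ¬ HasGoodOrdinaryModThreeType W →
    ∀ (κ : ZpExtension K 3), κ.IsAnticyclotomic →
    ∀ (𝔭' : HeightOneSpectrum (𝓞 K)), ((3 : ℕ) : 𝓞 K) ∈ 𝔭'.asIdeal →
      Set.Finite {s : AcSelmer.selmerAc (W.baseChange K) 3 κ 𝔭' ∅ | (3 : ℕ) • s = 0}

/-! ## §2 Glue (PROVED): the two strata exhaust the rows -/

/-- Excluded middle on the Serre stratum: the two row pieces give the μ-half of the wall verbatim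
(g8/g10 `ResidualSelmerFiniteAtThreeSurj`). [folklore] -/
theorem residualFinite_of_rows :
    SerreSourceResidualFiniteAtThree → ComplementRowsResidualFiniteAtThree → ResidualSelmerFiniteAtThreeSurj := by
  intro hR hC W _ _ N _ K _ _ hO6 hsurj hr1 hN hK hH κ hκ 𝔭' h3'
  by_cases hrow : HasGoodOrdinaryModThreeType W
  · exact hR W N K hO6 hsurj hr1 hN hK hH hrow κ hκ 𝔭' h3'
  · exact hC W N K hO6 hsurj hr1 hN hK hH hrow κ hκ 𝔭' h3'

/-- **Stratum R is closed under mod-3 congruence AT 3** (it is a property of the `D₃`-module `W[3]` only):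
bookkeeping for the transport step. [folklore] -/
theorem HasGoodOrdinaryModThreeType.of_modPCongruentAt {W W' : WeierstrassCurve ℚ}
    (h : HasGoodOrdinaryModThreeType W)
    (hc : ∀ (v : HeightOneSpectrum (𝓞 ℚ)), ((3 : ℕ) : 𝓞 ℚ) ∈ v.asIdeal → ModPCongruentAt W W' 3 v) :
    HasGoodOrdinaryModThreeType W' := by
  intro v hv
  obtain ⟨W'', h1, h2, hord, hW⟩ := h v hv
  exact ⟨W'', h1, h2, hord, hW.trans (hc v hv)⟩

/-- A good-ordinary curve lies in stratum R (witness: itself). [folklore] -/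
theorem hasGoodOrdinaryModThreeType_of_goodOrd (W : WeierstrassCurve ℚ) [W.IsElliptic] [W.IsGloballyMinimal]
    (h : GoodOrd W 3) : HasGoodOrdinaryModThreeType W :=
  fun v _ ↦ ⟨W, ‹_›, ‹_›, h, ModPCongruentAt.refl (W := W) (p := 3) (v := v)⟩

/-! ## §3 Registered-shape stubs (`sorry` only here) -/

/-- RATWALL (route crux 24207, WEAKER than the wall; LEAD line `thin_comb`). -/
theorem stub_ratwall : RationalSplitIMCInclusionAtThree := by
  sorry

/-- The SERRE SOURCE on stratum R (UNDECIDED · print-adjacent GL₂-type port). -/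
theorem stub_serreSourceRows : SerreSourceResidualFiniteAtThree := by
  sorry

/-- The complement strata (UNDECIDED · BARRIER / RESEARCH leaves). -/
theorem stub_complementRows : ComplementRowsResidualFiniteAtThree := by
  sorry

/-! ## §4 TOP composition: the crux BY NAME -/

/-- **The μ-half road (g10's kernel road, proof verbatim).** `Sel_{𝔭′}(K_∞,E[3^∞])[3]` finite makes `X = X_(∅,0)`
`Λ`-torsion with `Ch·R₀⟦T⟧ = (g)`, `g` having a unit coefficient (LANDED criterion, GV 2.8 shape); then `3 ∤ g` in the
domain `R₀⟦T⟧` where `3` is prime, so `g ∣ 3^k·L` (RATWALL) forces `g ∣ L`, i.e. `(L) ⊆ (g)`.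
[cite: GreenbergVatsal2000, §2 Prop. (2.8)] [cite: Washington1997, §7.1, §13.2] -/
theorem wall_of_ratwall_of_residualFinite :
    RationalSplitIMCInclusionAtThree → ResidualSelmerFiniteAtThreeSurj → AdditiveSplitIMCInclusionAtThree := by
  intro hR hF W _ _ N _ K _ _ Dt hO6 hsurj hr1 hN hK hH κ hκ γ _ 𝔭 h3 he hf 𝔭' h3' hne ι' hι ΩK Ωp L hΩK hΩp hL
  obtain ⟨k, hk⟩ := hR W N K Dt hO6 hsurj hr1 hN hK hH κ hκ γ 𝔭 h3 he hf 𝔭' h3' hne ι' hι ΩK Ωp L hΩK hΩp hL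
  have hfin := hF W N K hO6 hsurj hr1 hN hK hH κ hκ 𝔭' h3'
  obtain ⟨-, g, hg, i, hi⟩ :=
    Summit.BirchSwinnertonDyer.BirchSwinnertonDyer.Theorems.UniversalToricDescentAcDualMuZero.isTorsion_and_exists_generator_of_finite_pTorsion
      (W.baseChange K) 3 κ 𝔭' ∅ γ Set.finite_empty hfin
  rw [hg] at hk ⊢
  have hdvd : g ∣ ((3 : ℕ) : UnrSeries 3) ^ k * L := Ideal.mem_span_singleton.mp hk
  rw [← map_natCast (PowerSeries.C (R := unrIntegers 3))] at hdvd
  exact Ideal.span_singleton_le_span_singleton.mpr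
    (dvd_of_dvd_prime_pow_mul prime_C_three (not_C_three_dvd_of_norm_coeff_eq_one hi) k hdvd)

/-- **The wall from RATWALL + the Serre source on stratum R + the complement strata.**  Concludes
`AdditiveSplitIMCInclusionAtThree` BY NAME. [cite: GreenbergVatsal2000, §2 Prop. (2.8)] -/
theorem AdditiveSplitIMCInclusionAtThree_of :
    RationalSplitIMCInclusionAtThree → SerreSourceResidualFiniteAtThree → ComplementRowsResidualFiniteAtThree →
      AdditiveSplitIMCInclusionAtThree :=
  fun hRW hR hC ↦ wall_of_ratwall_of_residualFinite hRW (residualFinite_of_rows hR hC)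

/-- The top composition run on the registered-shape stubs: the crux BY NAME (sorries only through `stub_*`). -/
theorem AdditiveSplitIMCInclusionAtThree_holds_of_stubs : AdditiveSplitIMCInclusionAtThree :=
  AdditiveSplitIMCInclusionAtThree_of stub_ratwall stub_serreSourceRows stub_complementRows

end Summit.BirchSwinnertonDyer.BirchSwinnertonDyer.Cruxes.AdditiveSplitIMCInclusionAtThree.SerreSourceTransport

end
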